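import Summits.ValiantsHypothesis.ValiantsHypothesis.Theses.SliceSignRank

/-!
# ValiantsHypothesis / SliceSignRank — item `TwistedSumForm` (stmt-ValiantsHypothesis-15124), closed

The dictionary between the coefficient identity `coeff(x^σ, f) = sgn σ · Σ_t Π_i W_t(σ(i), i)` and the
polynomial identity `f = Σ_t det(W_t ∘ X)` for slice-supported `f`: expand each determinant by
`Matrix.det_apply'` into `Σ_σ sgn σ (Π_i W_t(σ i, i)) x^σ` and compare coefficients, the permutation
monomials being pairwise distinct (`permMonomial_injective`). HONEST FRAMING: bookkeeping; nothing
here is progress on `VP ≠ VNP`.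
-/

-- layout Summits/ValiantsHypothesis/ValiantsHypothesis forces the duplicated namespace component
set_option linter.dupNamespace false

namespace Summit.ValiantsHypothesis.ValiantsHypothesis.Theorems.SliceSignRank

open MvPolynomial Literature.Computability.AlgebraicComplexity

/-- `det(W ∘ X) = Σ_σ sgn σ (Π_i W(σ i, i)) · x^σ`. [folklore] -/
private theorem det_twist_eq {n : ℕ} (W : Matrix (Fin n) (Fin n) ℝ) :
    (Matrix.of fun a b => C ((W a b : ℝ) : ℂ) * (X (a, b) : MvPolynomial (Fin n × Fin n) ℂ)).det =
      ∑ σ : Equiv.Perm (Fin n), monomial (permMonomial σ)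
        (((Equiv.Perm.sign σ : ℤ) : ℂ) * ∏ i, ((W (σ i) i : ℝ) : ℂ)) := by
  rw [Matrix.det_apply']
  refine Finset.sum_congr rfl (fun σ _ => ?_)
  simp only [Matrix.of_apply]
  have hX : (∏ i, (X (σ i, i) : MvPolynomial (Fin n × Fin n) ℂ)) = monomial (permMonomial σ) 1 := by
    rw [permMonomial, monomial_sum_one]; rfl
  rw [Finset.prod_mul_distrib, ← map_prod C, hX, C_mul_monomial, mul_one,
    ← map_intCast (C : ℂ →+* MvPolynomial (Fin n × Fin n) ℂ), C_mul_monomial]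

/-- The coefficients of `Σ_t det(W_t ∘ X)`. [folklore] -/
private theorem coeff_sum_det_twist {n k : ℕ} (W : Fin k → Matrix (Fin n) (Fin n) ℝ)
    (d : Fin n × Fin n →₀ ℕ) :
    coeff d (∑ t, (Matrix.of fun a b => C ((W t a b : ℝ) : ℂ) *
      (X (a, b) : MvPolynomial (Fin n × Fin n) ℂ)).det) =
      ∑ σ : Equiv.Perm (Fin n), if permMonomial σ = d then
        ((Equiv.Perm.sign σ : ℤ) : ℂ) * ∑ t, ∏ i, ((W t (σ i) i : ℝ) : ℂ) else 0 := by
  simp_rw [det_twist_eq]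
  rw [coeff_sum]
  simp_rw [coeff_sum, coeff_monomial]
  rw [Finset.sum_comm]
  refine Finset.sum_congr rfl (fun σ _ => ?_)
  split_ifs with h
  · rw [Finset.mul_sum]
  · simp

/-- **Item `TwistedSumForm` (stmt-ValiantsHypothesis-15124).** [folklore] -/
theorem twistedSumForm_proof : Theses.SliceSignRank.TwistedSumForm := by
  unfold Theses.SliceSignRank.TwistedSumForm
  intro n k W f hf0
  have hg : ∀ σ : Equiv.Perm (Fin n), coeff (permMonomial σ) (∑ t, (Matrix.of fun a b =>
      C ((W t a b : ℝ) : ℂ) * (X (a, b) : MvPolynomial (Fin n × Fin n) ℂ)).det) =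
      ((Equiv.Perm.sign σ : ℤ) : ℂ) * ∑ t, ∏ i, ((W t (σ i) i : ℝ) : ℂ) := by
    intro σ
    rw [coeff_sum_det_twist, Finset.sum_eq_single σ]
    · rw [if_pos rfl]
    · intro σ' _ hne
      rw [if_neg (permMonomial_injective.ne hne)]
    · exact fun h => absurd (Finset.mem_univ σ) h
  have hg0 : ∀ d : Fin n × Fin n →₀ ℕ, (∀ ρ : Equiv.Perm (Fin n), permMonomial ρ ≠ d) →
      coeff d (∑ t, (Matrix.of fun a b =>
        C ((W t a b : ℝ) : ℂ) * (X (a, b) : MvPolynomial (Fin n × Fin n) ℂ)).det) = 0 := by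
    intro d hd
    rw [coeff_sum_det_twist]
    exact Finset.sum_eq_zero (fun σ _ => if_neg (hd σ))
  constructor
  · intro hcoeff
    ext d
    by_cases h : ∃ ρ : Equiv.Perm (Fin n), permMonomial ρ = d
    · obtain ⟨ρ, rfl⟩ := h
      rw [hcoeff ρ, hg ρ]
    · push Not at h
      rw [hf0 d h, hg0 d h]
  · intro hfg σ
    rw [hfg, hg σ]

end Summit.ValiantsHypothesis.ValiantsHypothesis.Theorems.SliceSignRank
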